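import Mathlib
import Literature.NumberTheory.LFunctions.Zhang2022.Section12U030SmoothingLemmas
import HarnessLib

/-!
# Zhang (2022) §12 u030: the sharp sum `Σ_{l<P″₂/dr} χ(l)ξ_j(l;d,r)l^{−(1−β₆+w)}` against its
# Gaussian smoothing — the "(4.2)–(4.3)" step of the proof of Lemma 12.3, kernel-checked

Topic `Literature/NumberTheory/LFunctions/Zhang2022` (Landau–Siegel audit tree; verdict-neutral).
Y. Zhang, *Discrete mean estimates and the Landau–Siegel zero*, arXiv:2211.02515v1 (2022)
[Zhang2022LandauSiegel] — **an unrefereed manuscript under adjudication**; ZHANG-L lane WP12, helper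
under the RT-02 node hTop25Ex (core `Typed.Sec12B.U030`, §12 p.70 u030). Nothing here asserts or denies
Theorems 1–2 of the manuscript; no Zhang step is assumed.

The proof of Lemma 12.3 (p.70, "in a way similar to the proof of Lemma 12.1 [sic: 12.2]") evaluates
`Σ_{l<P″₂/dr} χ(l)ξ_j(l;d,r)/l^{1−β₆+w}` (`Typed.Sec12B.innerSumLow`) by the route of p.69: "By (4.2) and
(4.3)" the SHARP sum is replaced by the `g`-weighted series `Σ_l χ(l)ξ_j(l;d,r)l^{−(1−β₆+w)}g(x/l)`,
`x = P″₂/dr`, which the Mellin transform turns into a Perron integral. This file PROVES that first step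
with an explicit smoothing parameter: for the Gaussian weight `g_Λ(y) = √(Λ/π)∫_{−∞}^{log y}e^{−Λu²}du`
(`GaussWeight.gWeight`, (4.1) has `Λ = 𝓛³⁰`) and ANY `Λ ≥ 𝓛¹⁰⁰`,

  `‖innerSumLow(w) − Σ_l χ(l)ξ₀ⱼ(l;d,r)l^{−(1−β₆+w)}g_Λ(x/l)‖ ≤ C𝓛⁻¹⁵`

uniformly in `j, d, r` (`P″₁ < dr < P₂`) and `|w| = α` (`innerSumLow_sub_smooth_le`). Route:
`|𝟙_{l<x} − g_Λ(x/l)| ≤ ½e^{−Λlog²(x/l)}` (`GaussWeight.abs_gWeight_sub_one_le`, `gWeight_le`); on the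
window `|log(x/l)| ≤ Λ^{−1/4}` the logarithmic mean of `|ξ₀ⱼ(·;d,r)|` is `O(Λ^{−1/4}log x)` by Shiu's
theorem for the divisor class (`Sieve.ShiuDivisorClass.shiu_divisor_class_logMean_Ioc`, `a = 2`) applied to
the MULTIPLICATIVE `n ↦ ‖ξ₀ⱼ(n;d,r)‖` (`Lemma83.xiZero_mul_of_coprime`; at primes
`≤ 2 + 21B log q + M/q`, `XiZeroMajorant.norm_xiZero_prime_le_of_(not_)dvd`; at prime powers
`≤ 1806(ν+1)³`, `Lemma83.norm_xiZero_prime_pow_le`); off the window the Gaussian factor `e^{−√Λ}` beats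
the crude `‖ξ₀ⱼ(l)‖ ≤ l¹⁴`. (The manuscript's own `Λ = 𝓛³⁰` would need the sharper prime value
`1 + O(α log q)`; the core `U030` is free to choose `Λ`, and its contour step
(`Section12U030Contour`) takes `Λ = exp(c𝓛^{1/10})`.)

## References

* Y. Zhang, arXiv:2211.02515v1 (2022), §12 p.70 (proof of Lemma 12.3), p.69 u024 ("By (4.2) and
  (4.3)"), §4 (4.1)–(4.3) p.18. [cite: Zhang2022LandauSiegel, §12 pp.69–70; §4 (4.1)–(4.3)]
* P. Shiu, J. reine angew. Math. 313 (1980), Thm 1. [cite: Shiu1980, Theorem 1]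
-/

noncomputable section

open Complex Real Finset

namespace Literature.NumberTheory.LFunctions.Zhang2022.Typed.Sec12B

open Literature.NumberTheory.LFunctions.Zhang2022.Skeleton
open Literature.NumberTheory.LFunctions.Zhang2022.GaussWeight

/-! ## The smoothing theorem -/

set_option maxHeartbeats 1600000 in
/-- **Sharp sum versus Gaussian smoothing, `O(𝓛⁻¹⁵)`** — the "(4.2)–(4.3)" step of the proof of
Lemma 12.3 (p.70 via p.69 u024), for the sum `Σ_{l<P″₂/dr} χ(l)ξ₀ⱼ(l;d,r)l^{−(1−β₆+w)}`
(`innerSumLow`): for all large `D`, every `j`, `d, r ≥ 1` with `P″₁ < dr < P₂`, `|w| = α`, and every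
smoothing parameter `Λ ≥ 𝓛¹⁰⁰`,
`‖innerSumLow(w) − Σ_l χ(l)ξ₀ⱼ(l;d,r)l^{−(1−β₆+w)}g_Λ(x/l)‖ ≤ C𝓛⁻¹⁵` (`x = P″₂/dr`, `C` absolute).
Proof: `|𝟙_{l<x} − g_Λ(x/l)| ≤ ½e^{−Λlog²(x/l)}`; the window `xe^{−δ} < l ≤ xe^{δ}`, `δ = 𝓛⁻²⁵`,
contributes `≤ 4e^{π}C_W·δ·𝓛⁹` (Shiu, `xiZero_window_logMean_le`); the other `l ≤ x²` contribute
`≤ ½e^{−Λδ²}P⁴⁵ ≤ ½e^{−𝓛}`; the tail `l > x²` is `≤ x⁻² ≤ e^{−20𝓛}`.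
[cite: Zhang2022LandauSiegel, §12 p.70; §4 (4.2)–(4.3)] -/
theorem innerSumLow_sub_smooth_le (c' : ℝ) : ∃ C : ℝ, ForAllLarge fun D _ χ =>
    ∀ j d r : ℕ, 1 ≤ d → 1 ≤ r →
      P1pp D < ((d * r : ℕ) : ℝ) → ((d * r : ℕ) : ℝ) < Skeleton.P2 D →
      ∀ w : ℂ, ‖w‖ = alpha D → ∀ Λ : ℝ, ell D ^ 100 ≤ Λ →
        ‖innerSumLow c' χ j d r w -
            ∑' l : ℕ, χ (l : ZMod D) * xiZero c' D j l d r / (l : ℂ) ^ (1 - beta6 D + w) *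
              (gWeight Λ (P2pp D / ((d * r : ℕ) : ℝ) / l) : ℂ)‖ ≤ C * (ell D ^ 15)⁻¹ := by
  obtain ⟨CW, x₀, hCW, hx₀, hW⟩ := xiZero_window_logMean_le c'
  obtain ⟨D₂, hD₂⟩ := exists_nat_forall_le_ell (max 45 (Real.log (2 * x₀)))
  obtain ⟨he4, he2, heq⟩ := exp_small_facts
  refine ⟨4 * Real.exp π * CW + 2 * (Nat.factorial 15 : ℝ),
    max ⌈Real.exp (5 * |c'| * π + 3)⌉₊ D₂,
    fun D _ χ hD _ _ j d r hd hr hdr1 hdr2 w hw Λ hΛ => ?_⟩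
  have hD₁ : ⌈Real.exp (5 * |c'| * π + 3)⌉₊ ≤ D := le_trans (le_max_left _ _) hD
  have hLm : max 45 (Real.log (2 * x₀)) ≤ ell D := hD₂ D (le_trans (le_max_right _ _) hD)
  set L := ell D with hLdef
  have hL45 : 45 ≤ L := le_trans (le_max_left _ _) hLm
  have hLx₀ : Real.log (2 * x₀) ≤ L := le_trans (le_max_right _ _) hLm
  have hL4 : 4 ≤ L := by linarith
  have hL1 : 1 ≤ L := by linarith
  have hL0 : 0 < L := by linarith
  have hd0 : d ≠ 0 := by omega
  have hr0 : r ≠ 0 := by omega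
  -- `α = π/𝓛⁹ ≤ 1/2`
  have hα : alpha D = π / L ^ 9 := by rw [alpha, log_bigP]
  have hα0 : 0 < alpha D := by rw [hα]; positivity
  have hαhalf : alpha D ≤ 1 / 2 := by
    rw [hα, div_le_iff₀ (by positivity)]
    have h9 : (4 : ℝ) ^ 9 ≤ L ^ 9 := pow_le_pow_left₀ (by norm_num) hL4 9
    nlinarith [Real.pi_le_four]
  -- the point `x` and its sizes
  set x : ℝ := P2pp D / ((d * r : ℕ) : ℝ) with hxdef
  obtain ⟨hxT, hxP⟩ := window_point_bounds hL1 hdr1 hdr2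
  have hP0 : 0 < bigP D := Real.exp_pos _
  have hlogP : Real.log (bigP D) = L ^ 9 := log_bigP D
  have hT : Real.exp L ≤ bigT D := by
    rw [bigT]
    apply Real.exp_le_exp.mpr
    calc L = L ^ (1 : ℝ) := (Real.rpow_one L).symm
      _ ≤ L ^ (1.1 : ℝ) := Real.rpow_le_rpow_of_exponent_le hL1 (by norm_num)
  have hx10 : Real.exp (10 * L) ≤ x := by
    calc Real.exp (10 * L) = Real.exp L ^ 10 := by rw [← Real.exp_nat_mul]; norm_num
      _ ≤ bigT D ^ 10 := pow_le_pow_left₀ (Real.exp_pos _).le hT 10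
      _ ≤ x := hxT
  have hx36 : 4 * L ^ 36 ≤ x := le_trans (four_mul_pow_le_exp_ten_mul hL45) hx10
  have hxe : Real.exp L ≤ x := le_trans (Real.exp_le_exp.mpr (by linarith)) hx10
  have hx1 : 1 ≤ x := le_trans (Real.one_le_exp hL0.le) hxe
  have hx0 : 0 < x := by linarith
  have hxx₀ : 2 * x₀ ≤ x := by
    have h0 : 0 < 2 * x₀ := by linarith
    calc 2 * x₀ = Real.exp (Real.log (2 * x₀)) := (Real.exp_log h0).symm
      _ ≤ Real.exp L := Real.exp_le_exp.mpr hLx₀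
      _ ≤ x := hxe
  have hx4 : 4 ≤ x := by linarith
  have hlogx : Real.log x ≤ L ^ 9 := by
    rw [← hlogP]; exact Real.log_le_log hx0 hxP
  -- the terms
  set T : ℕ → ℂ := fun l => χ (l : ZMod D) * xiZero c' D j l d r / (l : ℂ) ^ (1 - beta6 D + w)
    with hTdef
  set F : ℕ → ℂ := fun l => T l * (gWeight Λ (x / l) : ℂ) with hFdef
  have hΛ68 : 68 ≤ Λ := by
    have h100 : (4 : ℝ) ^ 100 ≤ L ^ 100 := pow_le_pow_left₀ (by norm_num) hL4 100
    have : (68 : ℝ) ≤ 4 ^ 100 := by norm_num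
    linarith
  have hΛ0 : 0 < Λ := by linarith
  have hT0 : T 0 = 0 := by
    simp only [hTdef, Lemma83.xiZero_apply_zero, Nat.cast_zero, mul_zero, zero_div]
  have hnormT : ∀ l : ℕ, 1 ≤ l →
      ‖T l‖ ≤ ‖xiZero c' D j l d r‖ * (((l : ℝ))⁻¹ * (l : ℝ) ^ alpha D) :=
    fun l hl => norm_term_le c' χ j d r hl hw.le
  have hpowle : ∀ l : ℕ, 1 ≤ l → (((l : ℝ))⁻¹ * (l : ℝ) ^ alpha D) ≤ 1 := by
    intro l hl
    have hl0 : (0 : ℝ) < l := by exact_mod_cast hl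
    rw [← Real.rpow_neg_one, ← Real.rpow_add hl0]
    exact Real.rpow_le_one_of_one_le_of_nonpos (by exact_mod_cast hl) (by linarith)
  -- the cut-offs
  set N : ℕ := ⌈x⌉₊ with hNdef
  set M : ℕ := ⌊x ^ 2⌋₊ + 1 with hMdef
  have hxM : x ^ 2 < M := by rw [hMdef]; push_cast; exact Nat.lt_floor_add_one _
  have hMx : (M : ℝ) ≤ x ^ 2 + 1 := by
    rw [hMdef]; push_cast; linarith [Nat.floor_le (sq_nonneg x)]
  have hNM : N ≤ M := by
    have h1 : (N : ℝ) < x + 1 := Nat.ceil_lt_add_one hx0.le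
    have h2 : x + 1 ≤ x ^ 2 := by nlinarith
    have h3 : N ≤ ⌊x ^ 2⌋₊ := Nat.le_floor (by linarith)
    omega
  have hMP : (M : ℝ) ≤ bigP D ^ 3 := by
    have hP1 : 1 ≤ bigP D := by linarith
    have h1 : x ^ 2 ≤ bigP D ^ 2 := pow_le_pow_left₀ hx0.le hxP 2
    have h2 : bigP D ^ 2 + 1 ≤ bigP D ^ 3 := by nlinarith
    linarith
  -- (i) summability of the tail and of `F`
  have htail_pt : ∀ i : ℕ, ‖F (i + M)‖ ≤ (1 / 2) * (x ^ 2)⁻¹ * ((((i + M : ℕ) : ℝ)) ^ 2)⁻¹ := by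
    intro i
    have hl1 : 1 ≤ i + M := by omega
    have hlR : x ^ 2 ≤ ((i + M : ℕ) : ℝ) := by
      have : (M : ℝ) ≤ ((i + M : ℕ) : ℝ) := by push_cast; linarith
      linarith
    have hl0 : (0 : ℝ) < ((i + M : ℕ) : ℝ) := by positivity
    have hle : Real.exp 1 ≤ ((i + M : ℕ) : ℝ) := by
      have h1 : Real.exp 1 ≤ x := le_trans (Real.exp_le_exp.mpr hL1) hxe
      nlinarith
    have hxl : x / ((i + M : ℕ) : ℝ) ≤ 1 := by rw [div_le_one hl0]; nlinarith
    have hg : gWeight Λ (x / ((i + M : ℕ) : ℝ)) ≤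
        (1 / 2) * rexp (-Λ * Real.log (x / ((i + M : ℕ) : ℝ)) ^ 2) :=
      gWeight_le hΛ0 (div_pos hx0 hl0) hxl
    have hg0 : 0 ≤ gWeight Λ (x / ((i + M : ℕ) : ℝ)) := (gWeight_pos hΛ0 _).le
    have hξ : ‖xiZero c' D j (i + M) d r‖ ≤ ((i + M : ℕ) : ℝ) ^ 14 :=
      norm_xiZero_le_pow_fourteen c' D j hd0 hr0 (by omega)
    have key := pow_mul_gauss_le_tail hΛ68 hx1 hlR hle
    rw [Real.rpow_neg hx0.le, Real.rpow_neg hl0.le, Real.rpow_two, Real.rpow_two,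
      show ((i + M : ℕ) : ℝ) ^ (14 : ℝ) = ((i + M : ℕ) : ℝ) ^ (14 : ℕ) by
        rw [← Real.rpow_natCast]; norm_num] at key
    calc ‖F (i + M)‖ = ‖T (i + M)‖ * gWeight Λ (x / ((i + M : ℕ) : ℝ)) := by
          rw [hFdef]; simp only [norm_mul, Complex.norm_real, Real.norm_eq_abs, abs_of_nonneg hg0]
      _ ≤ (‖xiZero c' D j (i + M) d r‖ * ((((i + M : ℕ) : ℝ))⁻¹ * ((i + M : ℕ) : ℝ) ^ alpha D)) *
            ((1 / 2) * rexp (-Λ * Real.log (x / ((i + M : ℕ) : ℝ)) ^ 2)) :=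
          mul_le_mul (hnormT (i + M) hl1) hg hg0 (by positivity)
      _ ≤ (((i + M : ℕ) : ℝ) ^ 14 * 1) *
            ((1 / 2) * rexp (-Λ * Real.log (x / ((i + M : ℕ) : ℝ)) ^ 2)) := by
          gcongr
          exact hpowle (i + M) hl1
      _ = (1 / 2) * (((i + M : ℕ) : ℝ) ^ 14 * rexp (-Λ * Real.log (x / ((i + M : ℕ) : ℝ)) ^ 2)) := by
          ring
      _ ≤ (1 / 2) * ((x ^ 2)⁻¹ * ((((i + M : ℕ) : ℝ)) ^ 2)⁻¹) := by gcongr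
      _ = _ := by ring
  have hsq : Summable fun n : ℕ => (((n : ℝ)) ^ 2)⁻¹ := Real.summable_nat_pow_inv.mpr (by norm_num)
  have hsqM : Summable fun i : ℕ => ((((i + M : ℕ) : ℝ)) ^ 2)⁻¹ := (summable_nat_add_iff M).mpr hsq
  have hgsum : Summable fun i : ℕ => (1 / 2) * (x ^ 2)⁻¹ * ((((i + M : ℕ) : ℝ)) ^ 2)⁻¹ :=
    hsqM.mul_left _
  have hFtail : Summable fun i : ℕ => F (i + M) := Summable.of_norm_bounded hgsum htail_pt
  have hF : Summable F := (summable_nat_add_iff M).mp hFtail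
  -- (ii) the tail is `≤ x⁻²`
  have htail : ‖∑' i : ℕ, F (i + M)‖ ≤ (x ^ 2)⁻¹ := by
    have h1 : ‖∑' i : ℕ, F (i + M)‖ ≤ ∑' i : ℕ, (1 / 2) * (x ^ 2)⁻¹ * ((((i + M : ℕ) : ℝ)) ^ 2)⁻¹ :=
      tsum_of_norm_bounded hgsum.hasSum htail_pt
    have h2 : ∑' i : ℕ, ((((i + M : ℕ) : ℝ)) ^ 2)⁻¹ ≤ 2 := by
      have h3 := hsq.sum_add_tsum_nat_add M
      have h4 : 0 ≤ ∑ i ∈ Finset.range M, (((i : ℝ)) ^ 2)⁻¹ :=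
        Finset.sum_nonneg fun i _ => by positivity
      linarith [tsum_inv_sq_le_two]
    rw [tsum_mul_left] at h1
    calc ‖∑' i : ℕ, F (i + M)‖ ≤ (1 / 2) * (x ^ 2)⁻¹ * ∑' i : ℕ, ((((i + M : ℕ) : ℝ)) ^ 2)⁻¹ := h1
      _ ≤ (1 / 2) * (x ^ 2)⁻¹ * 2 := by gcongr
      _ = (x ^ 2)⁻¹ := by ring
  -- (iii) the decomposition of the error
  have hsplit : ∑' l : ℕ, F l = ∑ l ∈ Finset.Ico 1 M, F l + ∑' i : ℕ, F (i + M) := by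
    rw [← hF.sum_add_tsum_nat_add M, Finset.range_eq_Ico,
      Finset.sum_eq_sum_Ico_succ_bot (by omega : 0 < M)]
    rw [hFdef]; simp only [hT0, zero_mul, zero_add]
  have hsharp : innerSumLow c' χ j d r w =
      ∑ l ∈ Finset.Ico 1 M, T l * ((if (l : ℝ) < x then (1 : ℝ) else 0 : ℝ) : ℂ) := by
    have hset : (Finset.Ico 1 M).filter (fun l : ℕ => (l : ℝ) < x) = Finset.Ico 1 N := by
      ext l
      simp only [Finset.mem_filter, Finset.mem_Ico, hNdef]
      constructor
      · rintro ⟨⟨h1, _⟩, h2⟩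
        exact ⟨h1, Nat.lt_ceil.mpr h2⟩
      · rintro ⟨h1, h2⟩
        exact ⟨⟨h1, lt_of_lt_of_le h2 hNM⟩, Nat.lt_ceil.mp h2⟩
    have h2 : ∀ l ∈ Finset.Ico 1 M, T l * ((if (l : ℝ) < x then (1 : ℝ) else 0 : ℝ) : ℂ) =
        if (l : ℝ) < x then T l else 0 := by
      intro l _
      split_ifs <;> simp
    rw [Finset.sum_congr rfl h2, ← Finset.sum_filter, hset, innerSumLow]
  have herr : innerSumLow c' χ j d r w - ∑' l : ℕ, F l =
      ∑ l ∈ Finset.Ico 1 M, T l * (((if (l : ℝ) < x then (1 : ℝ) else 0) - gWeight Λ (x / l) : ℝ) : ℂ) -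
        ∑' i : ℕ, F (i + M) := by
    rw [hsplit, hsharp, hFdef]
    simp only [Complex.ofReal_sub, mul_sub, Finset.sum_sub_distrib]
    ring
  -- (iv) the window `(x₁, x₂] = (xe^{−δ}, xe^{δ}]`
  set δ : ℝ := (L ^ 25)⁻¹ with hδdef
  have hδ0 : 0 < δ := by rw [hδdef]; positivity
  have hδ1 : δ ≤ 1 / 4 := by
    rw [hδdef]
    have : (4 : ℝ) ≤ L ^ 25 := le_trans hL4 (le_self_pow₀ hL1 (by norm_num))
    exact (inv_le_inv₀ (by positivity) (by norm_num)).mpr this |>.trans (by norm_num)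
  have hexpδ : Real.exp δ ≤ 2 := le_trans (Real.exp_le_exp.mpr hδ1) he4
  have hexp2δ : Real.exp (2 * δ) ≤ 2 := le_trans (Real.exp_le_exp.mpr (by linarith)) he2
  have hexpmδ : (1 / 2 : ℝ) ≤ Real.exp (-δ) := le_trans heq (Real.exp_le_exp.mpr (by linarith))
  set x₁ : ℝ := x * Real.exp (-δ) with hx₁def
  set x₂ : ℝ := x * Real.exp δ with hx₂def
  have hx₁0 : 0 < x₁ := by positivity
  have hx₁x : x₁ ≤ x := by
    have : Real.exp (-δ) ≤ 1 := by rw [Real.exp_le_one_iff]; linarith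
    calc x₁ = x * Real.exp (-δ) := rfl
      _ ≤ x * 1 := by gcongr
      _ = x := mul_one x
  have hxx₁ : x ≤ 2 * x₁ := by
    calc x = 2 * (x * (1 / 2)) := by ring
      _ ≤ 2 * (x * Real.exp (-δ)) := by gcongr
  have hx₂2x : x₂ ≤ 2 * x := by
    calc x₂ = x * Real.exp δ := rfl
      _ ≤ x * 2 := by gcongr
      _ = 2 * x := by ring
  have hx₂eq : x₂ = x₁ * Real.exp (2 * δ) := by
    rw [hx₂def, hx₁def, mul_assoc, ← Real.exp_add]; ring_nf
  have hx₀x₁ : x₀ ≤ x₁ := by linarith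
  have hx₁L : L ^ 36 ≤ x₁ := by linarith
  -- Shiu on the window
  have hShiu : ∑ n ∈ Finset.Ioc ⌊x₁⌋₊ ⌊x₂⌋₊, ‖xiZero c' D j n d r‖ / n ≤
      CW * ((x₂ - x₁) / x₁) * Real.log x₁ := by
    have hgap : x₁ + x₁ ^ (1 / 4 : ℝ) ≤ x₂ := by rw [hx₂eq, hδdef]; exact window_gap hL1 hx₁L
    have hx₂le : x₂ ≤ 2 * x₁ := by
      calc x₂ = x₁ * Real.exp (2 * δ) := hx₂eq
        _ ≤ x₁ * 2 := by gcongr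
        _ = 2 * x₁ := by ring
    exact hW D hD₁ j d r hd0 hr0 x₁ x₂ hx₀x₁ hgap hx₂le (hx₁x.trans hxP)
  have hwin_ratio : (x₂ - x₁) / x₁ ≤ 4 * δ := by
    rw [hx₂eq, show (x₁ * Real.exp (2 * δ) - x₁) / x₁ = Real.exp (2 * δ) - 1 by field_simp]
    have h2δ : |2 * δ| = 2 * δ := abs_of_pos (by linarith)
    have h := Real.abs_exp_sub_one_le (x := 2 * δ) (by rw [h2δ]; linarith)
    rw [h2δ] at h
    linarith [le_abs_self (Real.exp (2 * δ) - 1)]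
  have hlogx₁ : Real.log x₁ ≤ L ^ 9 := (Real.log_le_log hx₁0 hx₁x).trans hlogx
  have hlogx₁0 : 0 ≤ Real.log x₁ := Real.log_nonneg (by linarith)
  -- (v) pointwise bounds for the finite part
  set W : Finset ℕ := Finset.Ioc ⌊x₁⌋₊ ⌊x₂⌋₊ with hWdef
  set a : ℕ → ℝ := fun l => ‖T l‖ * |(if (l : ℝ) < x then (1 : ℝ) else 0) - gWeight Λ (x / l)|
    with hadef
  -- `P^α = e^π`
  have hPα : bigP D ^ alpha D = Real.exp π := by
    rw [Real.rpow_def_of_pos hP0, hlogP, hα]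
    congr 1; field_simp
  -- in the window
  have hin : ∀ l ∈ (Finset.Ico 1 M).filter (fun l => l ∈ W),
      a l ≤ Real.exp π * (‖xiZero c' D j l d r‖ / l) := by
    intro l hl
    rw [Finset.mem_filter, Finset.mem_Ico] at hl
    obtain ⟨⟨hl1, _⟩, hlW⟩ := hl
    rw [hWdef, Finset.mem_Ioc] at hlW
    have hl0 : (0 : ℝ) < l := by exact_mod_cast hl1
    have hlx₂ : (l : ℝ) ≤ x₂ := by
      have : (l : ℝ) ≤ ⌊x₂⌋₊ := by exact_mod_cast hlW.2
      exact this.trans (Nat.floor_le (by positivity))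
    have hl2P : (l : ℝ) ≤ 2 * bigP D := by linarith
    have hlα : (l : ℝ) ^ alpha D ≤ 2 * Real.exp π := by
      calc (l : ℝ) ^ alpha D ≤ (2 * bigP D) ^ alpha D := Real.rpow_le_rpow hl0.le hl2P hα0.le
        _ = (2 : ℝ) ^ alpha D * bigP D ^ alpha D := Real.mul_rpow (by norm_num) hP0.le
        _ ≤ 2 * Real.exp π := by
            rw [hPα]
            have h1 : (2 : ℝ) ^ alpha D ≤ 2 := by
              calc (2 : ℝ) ^ alpha D ≤ (2 : ℝ) ^ (1 : ℝ) :=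
                    Real.rpow_le_rpow_of_exponent_le (by norm_num) (by linarith)
                _ = 2 := Real.rpow_one 2
            exact mul_le_mul_of_nonneg_right h1 (Real.exp_pos π).le
    have hind : |(if (l : ℝ) < x then (1 : ℝ) else 0) - gWeight Λ (x / l)| ≤ 1 / 2 := by
      refine (abs_indicator_sub_gWeight_le hΛ0 hx0 hl1).trans ?_
      have : rexp (-Λ * Real.log (x / l) ^ 2) ≤ 1 := by
        rw [Real.exp_le_one_iff]; nlinarith [sq_nonneg (Real.log (x / l))]
      linarith
    have hξ0 : 0 ≤ ‖xiZero c' D j l d r‖ := norm_nonneg _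
    calc a l ≤ (‖xiZero c' D j l d r‖ * (((l : ℝ))⁻¹ * (l : ℝ) ^ alpha D)) * (1 / 2) :=
          mul_le_mul (hnormT l hl1) hind (abs_nonneg _) (by positivity)
      _ ≤ (‖xiZero c' D j l d r‖ * (((l : ℝ))⁻¹ * (2 * Real.exp π))) * (1 / 2) := by gcongr
      _ = Real.exp π * (‖xiZero c' D j l d r‖ / l) := by ring
  -- off the window
  have hoff : ∀ l ∈ (Finset.Ico 1 M).filter (fun l => l ∉ W),
      a l ≤ (1 / 2) * Real.exp (-(Λ * δ ^ 2)) * (bigP D ^ 3) ^ 14 := by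
    intro l hl
    rw [Finset.mem_filter, Finset.mem_Ico] at hl
    obtain ⟨⟨hl1, hlM⟩, hlW⟩ := hl
    rw [hWdef, Finset.mem_Ioc, not_and_or, not_lt, not_le] at hlW
    have hl0 : (0 : ℝ) < l := by exact_mod_cast hl1
    have hlP : (l : ℝ) ≤ bigP D ^ 3 := le_trans (by exact_mod_cast hlM.le) hMP
    -- `|log(x/l)| ≥ δ`
    have hlog : δ ^ 2 ≤ Real.log (x / l) ^ 2 := by
      rw [Real.log_div hx0.ne' hl0.ne']
      rcases hlW with h | h
      · have hlx₁ : (l : ℝ) ≤ x₁ := le_trans (by exact_mod_cast h) (Nat.floor_le hx₁0.le)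
        have h1 : Real.log l ≤ Real.log x₁ := Real.log_le_log hl0 hlx₁
        have h2 : Real.log x₁ = Real.log x - δ := by
          rw [hx₁def, Real.log_mul hx0.ne' (Real.exp_pos _).ne', Real.log_exp]; ring
        have h3 : δ ≤ Real.log x - Real.log l := by linarith
        exact pow_le_pow_left₀ hδ0.le h3 2
      · have hlx₂ : x₂ < l := by
          have h' : ((⌊x₂⌋₊ + 1 : ℕ) : ℝ) ≤ l := by exact_mod_cast h
          push_cast at h'
          linarith [Nat.lt_floor_add_one x₂]
        have h1 : Real.log x₂ < Real.log l := Real.log_lt_log (by positivity) hlx₂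
        have h2 : Real.log x₂ = Real.log x + δ := by
          rw [hx₂def, Real.log_mul hx0.ne' (Real.exp_pos _).ne', Real.log_exp]
        have h3 : δ ≤ -(Real.log x - Real.log l) := by linarith
        calc δ ^ 2 ≤ (-(Real.log x - Real.log l)) ^ 2 := pow_le_pow_left₀ hδ0.le h3 2
          _ = (Real.log x - Real.log l) ^ 2 := neg_sq _
    have hind : |(if (l : ℝ) < x then (1 : ℝ) else 0) - gWeight Λ (x / l)| ≤
        (1 / 2) * Real.exp (-(Λ * δ ^ 2)) := by
      refine (abs_indicator_sub_gWeight_le hΛ0 hx0 hl1).trans ?_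
      have : rexp (-Λ * Real.log (x / l) ^ 2) ≤ Real.exp (-(Λ * δ ^ 2)) := by
        apply Real.exp_le_exp.mpr
        have := mul_le_mul_of_nonneg_left hlog hΛ0.le
        linarith
      linarith
    have hξ : ‖xiZero c' D j l d r‖ ≤ (l : ℝ) ^ 14 :=
      norm_xiZero_le_pow_fourteen c' D j hd0 hr0 (by omega)
    calc a l ≤ (‖xiZero c' D j l d r‖ * (((l : ℝ))⁻¹ * (l : ℝ) ^ alpha D)) *
          ((1 / 2) * Real.exp (-(Λ * δ ^ 2))) :=
          mul_le_mul (hnormT l hl1) hind (abs_nonneg _) (by positivity)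
      _ ≤ ((l : ℝ) ^ 14 * 1) * ((1 / 2) * Real.exp (-(Λ * δ ^ 2))) := by
          gcongr
          exact hpowle l hl1
      _ ≤ ((bigP D ^ 3) ^ 14 * 1) * ((1 / 2) * Real.exp (-(Λ * δ ^ 2))) := by gcongr
      _ = _ := by ring
  -- (vi) the finite part
  have hfin : ∑ l ∈ Finset.Ico 1 M, a l ≤
      Real.exp π * (CW * (4 * δ) * L ^ 9) + (1 / 2) * Real.exp (-(Λ * δ ^ 2)) * (bigP D ^ 3) ^ 15 := by
    rw [← Finset.sum_filter_add_sum_filter_not (Finset.Ico 1 M) (fun l => l ∈ W) a]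
    apply add_le_add
    · calc ∑ l ∈ (Finset.Ico 1 M).filter (fun l => l ∈ W), a l
          ≤ ∑ l ∈ (Finset.Ico 1 M).filter (fun l => l ∈ W), Real.exp π * (‖xiZero c' D j l d r‖ / l) :=
            Finset.sum_le_sum hin
        _ ≤ ∑ l ∈ W, Real.exp π * (‖xiZero c' D j l d r‖ / l) := by
            apply Finset.sum_le_sum_of_subset_of_nonneg
            · intro l hl; exact (Finset.mem_filter.mp hl).2
            · intro l _ _; positivity
        _ = Real.exp π * ∑ l ∈ W, ‖xiZero c' D j l d r‖ / l := by rw [Finset.mul_sum]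
        _ ≤ Real.exp π * (CW * ((x₂ - x₁) / x₁) * Real.log x₁) :=
            mul_le_mul_of_nonneg_left hShiu (Real.exp_pos π).le
        _ ≤ Real.exp π * (CW * (4 * δ) * L ^ 9) := by
            apply mul_le_mul_of_nonneg_left _ (Real.exp_pos π).le
            exact mul_le_mul (mul_le_mul_of_nonneg_left hwin_ratio hCW) hlogx₁ hlogx₁0
              (by positivity)
    · calc ∑ l ∈ (Finset.Ico 1 M).filter (fun l => l ∉ W), a l
          ≤ ∑ l ∈ (Finset.Ico 1 M).filter (fun l => l ∉ W),
              (1 / 2) * Real.exp (-(Λ * δ ^ 2)) * (bigP D ^ 3) ^ 14 := Finset.sum_le_sum hoff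
        _ = ((Finset.Ico 1 M).filter (fun l => l ∉ W)).card *
              ((1 / 2) * Real.exp (-(Λ * δ ^ 2)) * (bigP D ^ 3) ^ 14) := by
            rw [Finset.sum_const, nsmul_eq_mul]
        _ ≤ (bigP D ^ 3) * ((1 / 2) * Real.exp (-(Λ * δ ^ 2)) * (bigP D ^ 3) ^ 14) := by
            apply mul_le_mul_of_nonneg_right _ (by positivity)
            have h1 := Finset.card_filter_le (Finset.Ico 1 M) (fun l => l ∉ W)
            have h2 : (Finset.Ico 1 M).card ≤ M := by simp
            have : (((Finset.Ico 1 M).filter (fun l => l ∉ W)).card : ℝ) ≤ M := by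
              exact_mod_cast h1.trans h2
            exact this.trans hMP
        _ = _ := by ring
  -- (vii) assemble
  have hnum1 := window_piece_le (C := CW) hL1 hCW
  have hnum2 : (1 / 2) * Real.exp (-(Λ * δ ^ 2)) * (bigP D ^ 3) ^ 15 ≤
      (1 / 2) * ((Nat.factorial 15 : ℝ) * (L ^ 15)⁻¹) := by
    have h := offwindow_piece_le hL4 hΛ
    rw [bigP]; exact h
  have hnum3 : (x ^ 2)⁻¹ ≤ (Nat.factorial 15 : ℝ) * (L ^ 15)⁻¹ := tail_piece_le hL0 hx10
  rw [herr]
  have hfinC : ‖∑ l ∈ Finset.Ico 1 M,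
      T l * (((if (l : ℝ) < x then (1 : ℝ) else 0) - gWeight Λ (x / l) : ℝ) : ℂ)‖ ≤
      ∑ l ∈ Finset.Ico 1 M, a l := by
    refine (norm_sum_le _ _).trans (Finset.sum_le_sum fun l _ => ?_)
    rw [hadef, norm_mul, Complex.norm_real, Real.norm_eq_abs]
  have hfact0 : 0 ≤ (Nat.factorial 15 : ℝ) * (L ^ 15)⁻¹ := by positivity
  calc ‖∑ l ∈ Finset.Ico 1 M,
          T l * (((if (l : ℝ) < x then (1 : ℝ) else 0) - gWeight Λ (x / l) : ℝ) : ℂ) -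
        ∑' i : ℕ, F (i + M)‖
      ≤ ‖∑ l ∈ Finset.Ico 1 M,
          T l * (((if (l : ℝ) < x then (1 : ℝ) else 0) - gWeight Λ (x / l) : ℝ) : ℂ)‖ +
        ‖∑' i : ℕ, F (i + M)‖ := norm_sub_le _ _
    _ ≤ (Real.exp π * (CW * (4 * δ) * L ^ 9) + (1 / 2) * Real.exp (-(Λ * δ ^ 2)) * (bigP D ^ 3) ^ 15) +
        (x ^ 2)⁻¹ := add_le_add (hfinC.trans hfin) htail
    _ ≤ (4 * Real.exp π * CW * (L ^ 15)⁻¹ + (1 / 2) * ((Nat.factorial 15 : ℝ) * (L ^ 15)⁻¹)) +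
        (Nat.factorial 15 : ℝ) * (L ^ 15)⁻¹ := add_le_add (add_le_add hnum1 hnum2) hnum3
    _ = (4 * Real.exp π * CW + (3 / 2) * (Nat.factorial 15 : ℝ)) * (L ^ 15)⁻¹ := by ring
    _ ≤ (4 * Real.exp π * CW + 2 * (Nat.factorial 15 : ℝ)) * (L ^ 15)⁻¹ := by
        gcongr; norm_num

end Literature.NumberTheory.LFunctions.Zhang2022.Typed.Sec12B
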